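import Summits.CriticalPhenomena.Ising3DConformalLimit.Theorems.EnergyNotSigmaSquaredMoebiusLimitExistsClusterMoveIneq
import Summits.CriticalPhenomena.Ising3DConformalLimit.Theorems.EnergyNotSigmaSquaredMoebiusLimitExistsDoubledThickening
import Summits.CriticalPhenomena.Ising3DConformalLimit.Theorems.EnergyNotSigmaSquaredMoebiusLimitExistsPedigreeAssembly
import Summits.CriticalPhenomena.Ising3DConformalLimit.Theorems.MoebiusLimitExists.Negative.RatioRegular
import Mathlib.Topology.MetricSpace.Thickening
import HarnessLib

/-!
# Lattice lifts of the doubled configurations of a cubic mirror cut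
(helpers for stub `pedigreeStep` of line `only-interaction-breaks-moebius`, crux `MoebiusLimitExists`,
item stmt-CriticalPhenomena-1344, route `EnergyNotSigmaSquared`)

The continuum recursion step `pedigreeStep` compares, at mesh `δ`, the LIFT `j ↦ δ • (Y j)` of a
lattice configuration `Y` (so that the pinned zoom at the lift is `ρ_pin(δ)^m ⟨∏σ_Y⟩`, the lattice
approximation of `δ y` being `y`) with the continuum doubled configurations `doubledA g T x`,
`doubledB g T x` of a configuration `x` cut by the mirror `{rdotZ g · = T}`; the lattice mirror used
is `latticeMirror g ⌊T/δ⌋`. This file collects the elementary estimates, all of the form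
"lattice object = continuum object up to `O(δ)`":
* `rescaledCorrelator_lift_ps`: the zoom at a lift;
* `abs_mul_zdot_latticeApprox_sub_le_ps`: `|δ g·[p/δ] − rdotZ g p| ≤ 4δ`, and the lattice side
  conditions of the cluster move inequality from the continuum cut conditions with margin `κ ≥ 4δ`
  (`zdot_latticeApprox_le_floor_ps`, `floor_le_zdot_latticeApprox_ps`);
* `norm_lift_latticeMirror_sub_reflectZ_le_ps`: `‖δ Θ[q/δ] − reflectZ g T p‖ ≤ 22δ + dist q p`;
* the configuration-level consequences for the doubled `A`- and `B`-configurations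
  (`dist_liftA_doubledA_le_ps`, `dist_liftB_doubledB_le_ps`) and for a pair of lifts differing by the
  move of one point (`dist_liftA_liftA_le_ps`, `liftA_eq_of_ne_ps`).

References: FILS 1978 §2 for the mirrors; the recursion is the standing disprover's (Disproof.lean §G).
No definitions are introduced (lifts are written `fun j => δ • siteVec (Y j)`).
-/

noncomputable section

open Filter Topology Set Function Metric
open Literature.Probability.LatticeModels

namespace Summit.CriticalPhenomena.Ising3DConformalLimit.MoebiusLimitExistsOnlyInteraction

open Summit.CriticalPhenomena.Ising3DConformalLimit.MoebiusLimitExistsNegative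
  (norm_le_two_mul_of_abs_le abs_apply_le_norm)

/-! ### Lifts of lattice configurations -/

/-- The pinned zoom at the lift `j ↦ δ • Y j` of a lattice configuration is `ρ_pin(δ)^m ⟨∏σ_Y⟩`
(`[δ y/δ] = y`). [folklore] -/
theorem rescaledCorrelator_lift_ps {δ : ℝ} (hδ : 0 < δ) {m : ℕ} (Y : Fin m → Site 3) :
    rescaledCorrelator (criticalCorr 3) rhoPin m δ (fun j => (δ • siteVec (Y j) : EuclideanSpace ℝ (Fin 3))) =
      rhoPin δ ^ m * criticalCorr 3 m Y := by
  rw [rescaledCorrelator_apply]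
  simp only [latticeApprox_smul_siteVec hδ]

/-- **Registered anchor of this helper file** (`liftZoom_ps`): the pinned zoom at the lift
`j ↦ δ • Y j` of a lattice configuration `Y` is `ρ_pin(δ)^m ⟨∏σ_Y⟩`, explicit-binder form of
`rescaledCorrelator_lift_ps`. [folklore] -/
theorem liftZoom_ps :
    ∀ (δ : ℝ), 0 < δ → ∀ (m : ℕ) (Y : Fin m → Site 3),
      rescaledCorrelator (criticalCorr 3) rhoPin m δ (fun j => δ • siteVec (Y j)) =
        rhoPin δ ^ m * criticalCorr 3 m Y :=
  fun _ hδ _ Y => rescaledCorrelator_lift_ps hδ Y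

/-- `‖δ [p/δ] − p‖₂ ≤ 2δ` (each coordinate is off by at most `δ`). [folklore] -/
theorem norm_lift_latticeApprox_sub_le_ps {δ : ℝ} (hδ : 0 < δ) (p : EuclideanSpace ℝ (Fin 3)) :
    ‖(δ • siteVec (latticeApprox δ p) : EuclideanSpace ℝ (Fin 3)) - p‖ ≤ 2 * δ := by
  refine norm_le_two_mul_of_abs_le fun i => ?_
  rw [PiLp.sub_apply, PiLp.smul_apply, siteVec_apply, smul_eq_mul]
  exact abs_mul_latticeApprox_sub_le hδ p i

/-- `‖δ [q/δ] − p‖₂ ≤ 2δ + dist q p`. [folklore] -/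
theorem norm_lift_latticeApprox_sub_le'_ps {δ : ℝ} (hδ : 0 < δ) (p q : EuclideanSpace ℝ (Fin 3)) :
    ‖(δ • siteVec (latticeApprox δ q) : EuclideanSpace ℝ (Fin 3)) - p‖ ≤ 2 * δ + dist q p := by
  have h := norm_sub_le ((δ • siteVec (latticeApprox δ q) : EuclideanSpace ℝ (Fin 3)) - q) (p - q)
  rw [sub_sub_sub_cancel_right] at h
  have h1 := norm_lift_latticeApprox_sub_le_ps hδ q
  have h2 : ‖p - q‖ = dist q p := by rw [dist_comm, dist_eq_norm]
  linarith

/-- `rdotZ g (δ y) = δ (g·y)`. [folklore] -/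
theorem rdotZ_smul_siteVec_ps (g : Site 3) (δ : ℝ) (y : Site 3) :
    rdotZ g (δ • siteVec y) = δ * zdot g y := by
  simp only [rdotZ, PiLp.smul_apply, siteVec_apply, smul_eq_mul, zdot, Int.cast_add, Int.cast_mul]
  ring

/-- `|δ g·[p/δ] − rdotZ g p| ≤ 4δ` for a cubic direction `g`. [folklore] -/
theorem abs_mul_zdot_latticeApprox_sub_le_ps {g : Site 3} (hg : IsCubicDir g) {δ : ℝ} (hδ : 0 < δ)
    (p : EuclideanSpace ℝ (Fin 3)) : |δ * zdot g (latticeApprox δ p) - rdotZ g p| ≤ 4 * δ := by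
  rw [← rdotZ_smul_siteVec_ps]
  refine (abs_rdotZ_sub_le_pa hg _ _).trans ?_
  rw [dist_eq_norm]
  linarith [norm_lift_latticeApprox_sub_le_ps hδ p]

/-- Lattice side condition BELOW the mirror: if `rdotZ g p + κ ≤ T` and `4δ ≤ κ` then
`g·[p/δ] ≤ ⌊T/δ⌋`. [folklore] -/
theorem zdot_latticeApprox_le_floor_ps {g : Site 3} (hg : IsCubicDir g) {δ κ T : ℝ} (hδ : 0 < δ)
    (hκ : 4 * δ ≤ κ) {p : EuclideanSpace ℝ (Fin 3)} (h : rdotZ g p + κ ≤ T) :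
    zdot g (latticeApprox δ p) ≤ ⌊T / δ⌋ := by
  have h1 := (abs_le.1 (abs_mul_zdot_latticeApprox_sub_le_ps hg hδ p)).2
  have h2 : T < δ * ((⌊T / δ⌋ : ℤ) + 1 : ℝ) := by
    have := Int.lt_floor_add_one (T / δ)
    rwa [div_lt_iff₀ hδ, mul_comm] at this
  have h3 : δ * (zdot g (latticeApprox δ p) : ℝ) < δ * ((⌊T / δ⌋ : ℤ) + 1 : ℝ) := by linarith
  have h4 : (zdot g (latticeApprox δ p) : ℝ) < (⌊T / δ⌋ : ℤ) + 1 := lt_of_mul_lt_mul_left h3 hδ.le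
  have h5 : zdot g (latticeApprox δ p) < ⌊T / δ⌋ + 1 := by exact_mod_cast h4
  omega

/-- Lattice side condition ABOVE the mirror: if `T + κ ≤ rdotZ g p` and `4δ ≤ κ` then
`⌊T/δ⌋ ≤ g·[p/δ]`. [folklore] -/
theorem floor_le_zdot_latticeApprox_ps {g : Site 3} (hg : IsCubicDir g) {δ κ T : ℝ} (hδ : 0 < δ)
    (hκ : 4 * δ ≤ κ) {p : EuclideanSpace ℝ (Fin 3)} (h : T + κ ≤ rdotZ g p) :
    ⌊T / δ⌋ ≤ zdot g (latticeApprox δ p) := by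
  have h1 := (abs_le.1 (abs_mul_zdot_latticeApprox_sub_le_ps hg hδ p)).1
  have h2 : δ * ((⌊T / δ⌋ : ℤ) : ℝ) ≤ T := by
    have := Int.floor_le (T / δ)
    rwa [le_div_iff₀ hδ, mul_comm] at this
  have h3 : δ * ((⌊T / δ⌋ : ℤ) : ℝ) ≤ δ * (zdot g (latticeApprox δ p) : ℝ) := by linarith
  exact_mod_cast le_of_mul_le_mul_left h3 hδ

/-- `0 ≤ T − δ⌊T/δ⌋ ≤ δ`, as `|δ⌊T/δ⌋ − T| ≤ δ`. [folklore] -/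
theorem abs_mul_floor_sub_le_ps {δ : ℝ} (hδ : 0 < δ) (T : ℝ) : |δ * ((⌊T / δ⌋ : ℤ) : ℝ) - T| ≤ δ := by
  have h1 : δ * ((⌊T / δ⌋ : ℤ) : ℝ) ≤ T := by
    have := Int.floor_le (T / δ)
    rwa [le_div_iff₀ hδ, mul_comm] at this
  have h2 : T < δ * ((⌊T / δ⌋ : ℤ) : ℝ) + δ := by
    have := Int.lt_floor_add_one (T / δ)
    rw [div_lt_iff₀ hδ] at this
    linarith
  rw [abs_le]
  constructor <;> linarith

/-! ### The lattice mirror versus the Euclidean mirror -/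

/-- `‖ĝ‖₂ ≤ 2` for a cubic direction. [folklore] -/
theorem norm_siteVec_le_two_ps {g : Site 3} (hg : IsCubicDir g) : ‖siteVec g‖ ≤ 2 := by
  have h := norm_le_two_mul_of_abs_le (w := siteVec g) (b := 1) fun i => by
    rw [siteVec_apply]
    rcases hg.1 i with h | h | h <;> simp [h]
  linarith

/-- The integer factor `2 / (g·g)` of the lattice mirror is the real number `2/(g·g)`. [folklore] -/
theorem cast_two_div_zdot_ps {g : Site 3} (hg : IsCubicDir g) :
    ((2 / zdot g g : ℤ) : ℝ) = 2 / ((zdot g g : ℤ) : ℝ) := by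
  rcases hg.2 with h | h <;> rw [h] <;> norm_num

/-- `0 < g·g ≤ 2` in `ℝ`, so `2/(g·g) ≤ 2`. [folklore] -/
theorem two_div_zdot_le_two_ps {g : Site 3} (hg : IsCubicDir g) :
    0 ≤ 2 / ((zdot g g : ℤ) : ℝ) ∧ 2 / ((zdot g g : ℤ) : ℝ) ≤ 2 := by
  rcases hg.2 with h | h <;> rw [h] <;> norm_num

/-- The lattice mirror in real coordinates: `δ Θ y = δ y − (2/(g·g)) (δ g·y − δ c) ĝ`. [folklore] -/
theorem smul_siteVec_latticeMirror_ps {g : Site 3} (hg : IsCubicDir g) (c : ℤ) (δ : ℝ) (y : Site 3) :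
    (δ • siteVec (latticeMirror g c y) : EuclideanSpace ℝ (Fin 3)) =
      δ • siteVec y - (2 / ((zdot g g : ℤ) : ℝ) * (δ * zdot g y - δ * c)) • siteVec g := by
  have hcast := cast_two_div_zdot_ps hg
  ext i
  simp only [PiLp.smul_apply, PiLp.sub_apply, siteVec_apply, smul_eq_mul, latticeMirror_apply,
    Int.cast_sub, Int.cast_mul, hcast]
  ring

/-- **`‖δ Θ[q/δ] − reflectZ g T q‖ ≤ 22δ`** for the lattice mirror `Θ = latticeMirror g ⌊T/δ⌋` of a cubic
direction: both are `v ↦ v − (2/(g·g))(g·v − height) ĝ` with `v`, `g·v` and the height off by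
`2δ`, `4δ`, `δ`. [folklore] -/
theorem norm_lift_latticeMirror_sub_reflectZ_le_ps {g : Site 3} (hg : IsCubicDir g) {δ : ℝ} (hδ : 0 < δ)
    (T : ℝ) (q : EuclideanSpace ℝ (Fin 3)) :
    ‖(δ • siteVec (latticeMirror g ⌊T / δ⌋ (latticeApprox δ q)) : EuclideanSpace ℝ (Fin 3)) -
        reflectZ g T q‖ ≤ 22 * δ := by
  set y := latticeApprox δ q with hy
  set n : ℝ := ((zdot g g : ℤ) : ℝ) with hn
  obtain ⟨hn0, hn2⟩ := two_div_zdot_le_two_ps hg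
  have hA : ‖(δ • siteVec y : EuclideanSpace ℝ (Fin 3)) - q‖ ≤ 2 * δ := norm_lift_latticeApprox_sub_le_ps hδ q
  have hB : |δ * zdot g y - rdotZ g q| ≤ 4 * δ := abs_mul_zdot_latticeApprox_sub_le_ps hg hδ q
  have hC : |δ * ((⌊T / δ⌋ : ℤ) : ℝ) - T| ≤ δ := abs_mul_floor_sub_le_ps hδ T
  -- the difference of the two mirror images
  have hdiff : (δ • siteVec (latticeMirror g ⌊T / δ⌋ y) : EuclideanSpace ℝ (Fin 3)) - reflectZ g T q =
      ((δ • siteVec y : EuclideanSpace ℝ (Fin 3)) - q) -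
        (2 / n * ((δ * zdot g y - rdotZ g q) - (δ * ((⌊T / δ⌋ : ℤ) : ℝ) - T))) • siteVec g := by
    ext i
    simp only [smul_siteVec_latticeMirror_ps hg, reflectZ, PiLp.sub_apply, PiLp.smul_apply, siteVec_apply,
      smul_eq_mul, hn]
    ring
  rw [hdiff]
  refine (norm_sub_le _ _).trans ?_
  rw [norm_smul, Real.norm_eq_abs, abs_mul, abs_of_nonneg hn0]
  have hcoef : |(δ * zdot g y - rdotZ g q) - (δ * ((⌊T / δ⌋ : ℤ) : ℝ) - T)| ≤ 5 * δ :=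
    (abs_sub _ _).trans (by linarith)
  have hg2 := norm_siteVec_le_two_ps hg
  have : 2 / n * |(δ * zdot g y - rdotZ g q) - (δ * ((⌊T / δ⌋ : ℤ) : ℝ) - T)| * ‖siteVec g‖ ≤
      2 * (5 * δ) * 2 := by
    refine mul_le_mul (mul_le_mul hn2 hcoef (abs_nonneg _) (by norm_num)) hg2 (norm_nonneg _) ?_
    positivity
  linarith

/-- `‖δ Θ[q/δ] − reflectZ g T p‖ ≤ 22δ + dist q p` (the Euclidean mirror does not increase
distances). [folklore] -/
theorem norm_lift_latticeMirror_sub_reflectZ_le'_ps {g : Site 3} (hg : IsCubicDir g) {δ : ℝ}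
    (hδ : 0 < δ) (T : ℝ) (p q : EuclideanSpace ℝ (Fin 3)) :
    ‖(δ • siteVec (latticeMirror g ⌊T / δ⌋ (latticeApprox δ q)) : EuclideanSpace ℝ (Fin 3)) -
        reflectZ g T p‖ ≤ 22 * δ + dist q p := by
  have h := norm_sub_le
    ((δ • siteVec (latticeMirror g ⌊T / δ⌋ (latticeApprox δ q)) : EuclideanSpace ℝ (Fin 3)) - reflectZ g T q)
    (reflectZ g T p - reflectZ g T q)
  rw [sub_sub_sub_cancel_right] at h
  refine h.trans (add_le_add (norm_lift_latticeMirror_sub_reflectZ_le_ps hg hδ T q) ?_)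
  rw [← dist_eq_norm, dist_comm]
  exact dist_reflectZ_le_pa g T q p

/-! ### Configuration level -/

/-- **The lifted lattice doubled `A`-configuration is `O(δ)`-close to `doubledA g T x`.** For
configurations `s, t` (supplying the kept block and the mirrored block) and the reference `x`:
`dist (δ (Y_s ++ Θ Y_t)) (doubledA g T x) ≤ 22δ + max (dist s x) (dist t x)`, where
`Y_s j = [s (castAdd b j)/δ]`. [folklore] -/
theorem dist_liftA_doubledA_le_ps {g : Site 3} (hg : IsCubicDir g) {δ : ℝ} (hδ : 0 < δ) (T : ℝ)
    {a b : ℕ} (s t x : Fin (a + b) → EuclideanSpace ℝ (Fin 3)) :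
    dist (fun j => (δ • siteVec (Fin.append (fun j => latticeApprox δ (s (Fin.castAdd b j)))
        (latticeMirror g ⌊T / δ⌋ ∘ fun j => latticeApprox δ (t (Fin.castAdd b j))) j) :
          EuclideanSpace ℝ (Fin 3)))
      (doubledA g T x) ≤ 22 * δ + max (dist s x) (dist t x) := by
  refine (dist_pi_le_iff (by positivity)).2 fun j => ?_
  refine Fin.addCases (fun j => ?_) (fun j => ?_) j
  · rw [Fin.append_left, doubledA_left, dist_eq_norm]
    refine (norm_lift_latticeApprox_sub_le'_ps hδ _ _).trans ?_
    have := dist_le_pi_dist s x (Fin.castAdd b j)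
    have := le_max_left (dist s x) (dist t x)
    linarith
  · rw [Fin.append_right, doubledA_right, dist_eq_norm, Function.comp_apply]
    refine (norm_lift_latticeMirror_sub_reflectZ_le'_ps hg hδ T _ _).trans ?_
    have := dist_le_pi_dist t x (Fin.castAdd b j)
    have := le_max_right (dist s x) (dist t x)
    linarith

/-- **The lifted lattice doubled `B`-configuration is `22δ`-close to `doubledB g T x`.** [folklore] -/
theorem dist_liftB_doubledB_le_ps {g : Site 3} (hg : IsCubicDir g) {δ : ℝ} (hδ : 0 < δ) (T : ℝ)
    {a b : ℕ} (x : Fin (a + b) → EuclideanSpace ℝ (Fin 3)) :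
    dist (fun j => (δ • siteVec (Fin.append
        (latticeMirror g ⌊T / δ⌋ ∘ fun j => latticeApprox δ (x (Fin.natAdd a j)))
        (fun j => latticeApprox δ (x (Fin.natAdd a j))) j) : EuclideanSpace ℝ (Fin 3)))
      (doubledB g T x) ≤ 22 * δ := by
  refine (dist_pi_le_iff (by positivity)).2 fun j => ?_
  refine Fin.addCases (fun j => ?_) (fun j => ?_) j
  · rw [Fin.append_left, doubledB_left, dist_eq_norm, Function.comp_apply]
    exact norm_lift_latticeMirror_sub_reflectZ_le_ps hg hδ T _
  · rw [Fin.append_right, doubledB_right, dist_eq_norm]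
    linarith [norm_lift_latticeApprox_sub_le_ps hδ (x (Fin.natAdd a j))]

/-- Two lifts with the same mirrored block and kept blocks from `x`, `x'` are within
`4δ + dist x x'`. [folklore] -/
theorem dist_liftA_liftA_le_ps (g : Site 3) {δ : ℝ} (hδ : 0 < δ) (c : ℤ) {a b : ℕ}
    (x x' : Fin (a + b) → EuclideanSpace ℝ (Fin 3)) (Z : Fin a → Site 3) :
    dist (fun j => (δ • siteVec (Fin.append (fun j => latticeApprox δ (x (Fin.castAdd b j)))
        (latticeMirror g c ∘ Z) j) : EuclideanSpace ℝ (Fin 3)))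
      (fun j => (δ • siteVec (Fin.append (fun j => latticeApprox δ (x' (Fin.castAdd b j)))
        (latticeMirror g c ∘ Z) j) : EuclideanSpace ℝ (Fin 3))) ≤ 4 * δ + dist x x' := by
  refine (dist_pi_le_iff (by positivity)).2 fun j => ?_
  refine Fin.addCases (fun j => ?_) (fun j => ?_) j
  · simp only [Fin.append_left]
    rw [dist_eq_norm]
    have h1 := norm_lift_latticeApprox_sub_le_ps hδ (x (Fin.castAdd b j))
    have h2 := norm_lift_latticeApprox_sub_le_ps hδ (x' (Fin.castAdd b j))
    have h3 : dist (x (Fin.castAdd b j)) (x' (Fin.castAdd b j)) ≤ dist x x' := dist_le_pi_dist x x' _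
    rw [dist_eq_norm] at h3
    have h := norm_sub_le_norm_sub_add_norm_sub
      (δ • siteVec (latticeApprox δ (x (Fin.castAdd b j))) : EuclideanSpace ℝ (Fin 3))
      (x (Fin.castAdd b j)) (δ • siteVec (latticeApprox δ (x' (Fin.castAdd b j))))
    have h' := norm_sub_le_norm_sub_add_norm_sub (x (Fin.castAdd b j)) (x' (Fin.castAdd b j))
      (δ • siteVec (latticeApprox δ (x' (Fin.castAdd b j))) : EuclideanSpace ℝ (Fin 3))
    rw [norm_sub_rev (x' (Fin.castAdd b j))] at h'
    linarith
  · simp only [Fin.append_right]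
    rw [dist_self]
    positivity

/-- Two such lifts differ only at the kept index `castAdd a i₀` when `x`, `x'` differ only at
`castAdd b i₀`. [folklore] -/
theorem liftA_eq_of_ne_ps (g : Site 3) (δ : ℝ) (c : ℤ) {a b : ℕ} {i₀ : Fin a}
    {x x' : Fin (a + b) → EuclideanSpace ℝ (Fin 3)} (hdiff : ∀ l, l ≠ Fin.castAdd b i₀ → x' l = x l)
    (Z : Fin a → Site 3) :
    ∀ j, j ≠ Fin.castAdd a i₀ →
      (fun j => (δ • siteVec (Fin.append (fun j => latticeApprox δ (x' (Fin.castAdd b j)))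
        (latticeMirror g c ∘ Z) j) : EuclideanSpace ℝ (Fin 3))) j =
      (fun j => (δ • siteVec (Fin.append (fun j => latticeApprox δ (x (Fin.castAdd b j)))
        (latticeMirror g c ∘ Z) j) : EuclideanSpace ℝ (Fin 3))) j := by
  intro j hj
  refine Fin.addCases (fun j hj => ?_) (fun j _ => ?_) j hj
  · simp only [Fin.append_left]
    have hne : Fin.castAdd b j ≠ Fin.castAdd b i₀ := fun h => hj (by rw [Fin.castAdd_inj.1 h])
    rw [hdiff _ hne]
  · simp only [Fin.append_right]

end Summit.CriticalPhenomena.Ising3DConformalLimit.MoebiusLimitExistsOnlyInteraction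

end
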